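import Summits.CriticalPhenomena.Ising3DConformalLimit.Theorems.HyperoctahedralRPCriticalCorrNineMirrorRP
import Summits.CriticalPhenomena.Ising3DConformalLimit.Theorems.EnergyNotSigmaSquaredMoebiusLimitExistsClusterMoveIneqAux
import Literature.Probability.LatticeModels.RegularScales
import HarnessLib

/-!
# The nine lattice mirror families of `ℤ³` at every integer height: reflection positivity,
invariance and metric bookkeeping (route MirrorHoelderCompactness, helper for item
stmt-CriticalPhenomena-6151 `SeparableHoelder`)

For each of the nine nearest-neighbour-Ising RP mirror families of `ℤ³` — coordinate planes
`v_i = c`, diagonal planes `v_i - v_j = c`, anti-diagonal planes `v_i + v_j = c` (`i ≠ j`,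
`c ∈ ℤ`) — we produce a pair `(Θ, φ)` (lattice involution, integer level) with

* `Θ ∘ Θ = id`, `φ ∘ Θ = -φ`, `criticalCorr 3` is `Θ`-invariant, and the Gram form
  `(z, z') ↦ ⟨∏σ_{Θz} ∏σ_{z'}⟩_{β_c}` is positive semidefinite on spin monomials supported in the
  closed half `{φ ≥ 0}` (site-mirror reflection positivity, FILS 1978 §2, through the tree theorems
  `criticalCorr_levelMirror_rp` for the mirrors through the origin and `rp_conj_translate` /
  `criticalCorr_conj_translate` for the conjugation by a lattice translation), and on the other
  closed half `{φ ≤ 0}` as well (`rp_nonpos_of_rp`, by `Θ`-invariance);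
* the metric facts consumed by the Hölder estimate: `Θ` is an isometry for the sup-norm and the
  `ℓ¹`-distance, `|φ v + φ v'| ≤ 2‖Θ v - v'‖_∞` (points on opposite sides of the mirror are far
  apart) and `|φ v - φ v'| ≤ ‖v - v'‖₁`.

The levels are literally `φ v = v i - c`, `φ v = v i - v j - c`, `φ v = v i + v j - c`, matching the
nine-normal separation clause `⟪u, ·⟫` (`u = e_i, e_i - e_j, e_i + e_j`) of the item
`SeparableHoelder`. References: J. Fröhlich, R. Israel, E. H. Lieb, B. Simon, Comm. Math. Phys. 62
(1978) §2–3 [FILS1978]; S. Friedli, Y. Velenik, *Statistical Mechanics of Lattice Systems* (CUP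
2017), Lemma 10.8 and Exercise 3.14 [FriedliVelenik2017]. No definitions are introduced (the data
of a mirror are carried as hypotheses, in the shape of `clusterMoveIneq_of_rp`).
-/

noncomputable section

open Finset
open scoped BigOperators

namespace Summit.CriticalPhenomena.Ising3DConformalLimit.MirrorHoelderCompactnessSeparableHoelder

open Literature.Probability.LatticeModels
open Literature.Probability.Percolation (zdGraph_adj_signedPerm signedPerm_mem_box_iff)
open Summit.CriticalPhenomena.Ising3DConformalLimit.HyperoctahedralRPNineMirror
open Summit.CriticalPhenomena.Ising3DConformalLimit.Cruxes.InversionUpgradeNormalised.FreeEndpointGaussianClosure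
  (mirror_involutive mirror_adj mem_box_iff_mirror_mem_box apply_le_add_one_of_adj)
open Summit.CriticalPhenomena.Ising3DConformalLimit.MoebiusLimitExistsOnlyInteraction
  (criticalCorr_comp_involutive rp_conj_translate criticalCorr_conj_translate comp_append)

/-! ### Mirrors through the origin: invariance and reflection positivity together -/

/-- **Invariance and site-mirror RP of the critical `ℤ³` correlators for a level mirror through
the origin.** For an involutive automorphism `θ` of the nearest-neighbour graph `ℤ³` mapping the
centred boxes to themselves and an integer level `ℓ` with `ℓ ∘ θ = -ℓ`, `θ = id` on `{ℓ = 0}` and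
`|ℓ x - ℓ y| ≤ 1` along edges: `criticalCorr 3` is `θ`-invariant and
`0 ≤ Σ_{a,b} c_a c_b ⟨∏ σ_{θ z^a ++ z^b}⟩_{β_c}` for configurations `z^a` in `{ℓ ≥ 0}` (the tree
theorems `criticalCorr_comp_involutive` and `criticalCorr_levelMirror_rp`). [cite: FrohlichEtAl1978, §3 Thm 3.1] -/
theorem sym_and_rp_of_levelMirror (θ : Site 3 → Site 3) (hθ : Function.Involutive θ)
    (hθG : ∀ x y, (zdGraph 3).Adj x y → (zdGraph 3).Adj (θ x) (θ y))
    (ℓ : Site 3 → ℤ) (hℓθ : ∀ x, ℓ (θ x) = -ℓ x) (hfix : ∀ x, ℓ x = 0 → θ x = x)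
    (hadj : ∀ x y, (zdGraph 3).Adj x y → ℓ x ≤ ℓ y + 1 ∧ ℓ y ≤ ℓ x + 1)
    (hbox : ∀ (L : ℕ) (x : Site 3), x ∈ box 3 L ↔ θ x ∈ box 3 L) :
    (∀ (n : ℕ) (y : Fin n → Site 3), criticalCorr 3 n (θ ∘ y) = criticalCorr 3 n y) ∧
    ∀ (m : ℕ) (k : Fin m → ℕ) (z : (a : Fin m) → Fin (k a) → Site 3) (c : Fin m → ℝ),
      (∀ a j, 0 ≤ ℓ (z a j)) →
      0 ≤ ∑ a, ∑ b, c a * c b * criticalCorr 3 (k a + k b) (Fin.append (θ ∘ z a) (z b)) :=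
  ⟨fun _ y => criticalCorr_comp_involutive hθ hθG (fun L x hx => (hbox L x).1 hx) y,
    fun m k z c hz => criticalCorr_levelMirror_rp θ hθ hθG ℓ hℓθ hfix hadj hbox m k z c hz⟩

/-! ### All heights: conjugation by a lattice translation; the other closed half -/

/-- **Conjugation by a lattice translation.** If `(Θ, φ)` is an involution with an antisymmetric
level for which `criticalCorr 3` is invariant and reflection positive on `{φ ≥ 0}`, then so is the
conjugate mirror `v ↦ Θ (v - w) + w` with level `φ (· - w)` (translation invariance of the critical
state, `criticalCorr_translate`). [cite: FriedliVelenik2017, Exercise 3.14, p. 115] -/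
theorem mirror_conj {Θ : Site 3 → Site 3} {φ : Site 3 → ℤ}
    (hinv : ∀ v, Θ (Θ v) = v) (hφ : ∀ v, φ (Θ v) = -φ v)
    (hsym : ∀ (n : ℕ) (y : Fin n → Site 3), criticalCorr 3 n (Θ ∘ y) = criticalCorr 3 n y)
    (hRP : ∀ (m : ℕ) (k : Fin m → ℕ) (z : (a : Fin m) → Fin (k a) → Site 3) (c : Fin m → ℝ),
      (∀ a j, 0 ≤ φ (z a j)) →
      0 ≤ ∑ a, ∑ b, c a * c b * criticalCorr 3 (k a + k b) (Fin.append (Θ ∘ z a) (z b)))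
    (w : Site 3) :
    (∀ v, (fun v => Θ (v - w) + w) ((fun v => Θ (v - w) + w) v) = v) ∧
    (∀ v, (fun v => φ (v - w)) ((fun v => Θ (v - w) + w) v) = -(fun v => φ (v - w)) v) ∧
    (∀ (n : ℕ) (y : Fin n → Site 3),
      criticalCorr 3 n ((fun v => Θ (v - w) + w) ∘ y) = criticalCorr 3 n y) ∧
    ∀ (m : ℕ) (k : Fin m → ℕ) (z : (a : Fin m) → Fin (k a) → Site 3) (c : Fin m → ℝ),
      (∀ a j, 0 ≤ (fun v => φ (v - w)) (z a j)) →
      0 ≤ ∑ a, ∑ b, c a * c b *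
        criticalCorr 3 (k a + k b) (Fin.append ((fun v => Θ (v - w) + w) ∘ z a) (z b)) :=
  ⟨fun v => by simp [hinv], fun v => by simp [hφ], fun n y => criticalCorr_conj_translate hsym w n y,
    fun _ k z c hz => rp_conj_translate hRP w k z c hz⟩

/-- **Reflection positivity on the other closed half.** For an involution `Θ` with antisymmetric
level `φ` leaving `criticalCorr 3` invariant, RP on `{φ ≥ 0}` implies RP on `{φ ≤ 0}`: apply it to
the mirrored configurations `Θ z^a ⊆ {φ ≥ 0}` and use the invariance on the concatenation.
[cite: FrohlichEtAl1978, §2] -/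
theorem rp_nonpos_of_rp {Θ : Site 3 → Site 3} {φ : Site 3 → ℤ}
    (hinv : ∀ v, Θ (Θ v) = v) (hφ : ∀ v, φ (Θ v) = -φ v)
    (hsym : ∀ (n : ℕ) (y : Fin n → Site 3), criticalCorr 3 n (Θ ∘ y) = criticalCorr 3 n y)
    (hRP : ∀ (m : ℕ) (k : Fin m → ℕ) (z : (a : Fin m) → Fin (k a) → Site 3) (c : Fin m → ℝ),
      (∀ a j, 0 ≤ φ (z a j)) →
      0 ≤ ∑ a, ∑ b, c a * c b * criticalCorr 3 (k a + k b) (Fin.append (Θ ∘ z a) (z b)))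
    (m : ℕ) (k : Fin m → ℕ) (z : (a : Fin m) → Fin (k a) → Site 3) (c : Fin m → ℝ)
    (hz : ∀ a j, φ (z a j) ≤ 0) :
    0 ≤ ∑ a, ∑ b, c a * c b * criticalCorr 3 (k a + k b) (Fin.append (Θ ∘ z a) (z b)) := by
  have hΘΘ : ∀ {n : ℕ} (y : Fin n → Site 3), Θ ∘ (Θ ∘ y) = y := fun y => funext fun j => hinv (y j)
  have h := hRP m k (fun a => Θ ∘ z a) c (fun a j => by
    show 0 ≤ φ (Θ (z a j))
    rw [hφ]
    linarith [hz a j])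
  refine h.trans_eq (Finset.sum_congr rfl fun a _ => Finset.sum_congr rfl fun b _ => ?_)
  congr 1
  rw [hΘΘ, ← hsym, comp_append, hΘΘ]

/-! ### Sup-norm and `ℓ¹` bookkeeping on `ℤ³` -/

/-- Two sites whose coordinates agree in absolute value after a relabelling have the same sup-norm.
[folklore] -/
theorem supNorm_eq_of_natAbs_perm {d : ℕ} {a b : Site d} (σ : Equiv.Perm (Fin d))
    (h : ∀ k, (a k).natAbs = (b (σ k)).natAbs) : Site.supNorm a = Site.supNorm b := by
  apply le_antisymm
  · rw [Site.supNorm_le_iff]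
    intro k
    rw [h k]
    exact Site.natAbs_le_supNorm b (σ k)
  · rw [Site.supNorm_le_iff]
    intro k
    have hk := h (σ.symm k)
    rw [Equiv.apply_symm_apply] at hk
    rw [← hk]
    exact Site.natAbs_le_supNorm a (σ.symm k)

/-- Two pairs of sites whose coordinate differences agree in absolute value after a relabelling
have the same `ℓ¹` distance. [folklore] -/
theorem l1Dist_eq_of_natAbs_perm {d : ℕ} {a b a' b' : Site d} (σ : Equiv.Perm (Fin d))
    (h : ∀ k, (a k - b k).natAbs = (a' (σ k) - b' (σ k)).natAbs) :
    Site.l1Dist a b = Site.l1Dist a' b' := by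
  unfold Site.l1Dist
  rw [show (∑ k, (a k - b k).natAbs) = ∑ k, (a' (σ k) - b' (σ k)).natAbs from
    Finset.sum_congr rfl fun k _ => h k]
  exact Equiv.sum_comp σ (fun k => (a' k - b' k).natAbs)

/-- A coordinate is bounded by the sup-norm, integer form. [folklore] -/
theorem abs_apply_le_supNorm {d : ℕ} (a : Site d) (k : Fin d) : |a k| ≤ (Site.supNorm a : ℤ) := by
  have h := Site.natAbs_le_supNorm a k
  rw [Int.abs_eq_natAbs]
  exact_mod_cast h

/-- A coordinate difference is bounded by the `ℓ¹` distance, integer form. [folklore] -/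
theorem abs_sub_apply_le_l1Dist {d : ℕ} (a b : Site d) (k : Fin d) :
    |a k - b k| ≤ (Site.l1Dist a b : ℤ) := by
  have h : (a k - b k).natAbs ≤ Site.l1Dist a b :=
    Finset.single_le_sum (f := fun k => (a k - b k).natAbs) (fun _ _ => Nat.zero_le _)
      (Finset.mem_univ k)
  rw [Int.abs_eq_natAbs]
  exact_mod_cast h

/-- Two distinct coordinate differences are jointly bounded by the `ℓ¹` distance. [folklore] -/
theorem abs_sub_add_abs_sub_le_l1Dist {d : ℕ} (a b : Site d) {i j : Fin d} (hij : i ≠ j) :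
    |a i - b i| + |a j - b j| ≤ (Site.l1Dist a b : ℤ) := by
  have h : (a i - b i).natAbs + (a j - b j).natAbs ≤ Site.l1Dist a b := by
    unfold Site.l1Dist
    rw [← Finset.sum_pair (f := fun k => (a k - b k).natAbs) hij]
    exact Finset.sum_le_sum_of_subset (Finset.subset_univ _)
  rw [Int.abs_eq_natAbs, Int.abs_eq_natAbs]
  exact_mod_cast h

/-- The sup-norm of a difference is at most the `ℓ¹` distance. [folklore] -/
theorem supNorm_sub_le_l1Dist {d : ℕ} (a b : Site d) : Site.supNorm (a - b) ≤ Site.l1Dist a b := by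
  rw [Site.supNorm_le_iff]
  intro k
  exact Finset.single_le_sum (f := fun k => (a k - b k).natAbs) (fun _ _ => Nat.zero_le _)
    (Finset.mem_univ k)

/-! ### The three families -/

/-- **Coordinate mirrors `v_i = c`.** With `Θ v = (Θ₀ (v - c e_i)) + c e_i`, `Θ₀` the sign change
of the `i`-th coordinate, and level `φ v = v_i - c`: involution, antisymmetric level,
`criticalCorr 3` invariant, RP on `{φ ≥ 0}`, `Θ` a sup-norm and `ℓ¹` isometry,
`|φ v + φ v'| ≤ 2‖Θ v - v'‖_∞` and `|φ v - φ v'| ≤ ‖v - v'‖₁`. [cite: FrohlichEtAl1978, §3 Thm 3.1] -/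
theorem coordMirror (i : Fin 3) (c : ℤ) :
    ∃ (Θ : Site 3 → Site 3) (φ : Site 3 → ℤ), (∀ v, φ v = v i - c) ∧
    (∀ v, Θ (Θ v) = v) ∧ (∀ v, φ (Θ v) = -φ v) ∧
    (∀ (n : ℕ) (y : Fin n → Site 3), criticalCorr 3 n (Θ ∘ y) = criticalCorr 3 n y) ∧
    (∀ (m : ℕ) (k : Fin m → ℕ) (z : (a : Fin m) → Fin (k a) → Site 3) (cf : Fin m → ℝ),
      (∀ a j, 0 ≤ φ (z a j)) →
      0 ≤ ∑ a, ∑ b, cf a * cf b * criticalCorr 3 (k a + k b) (Fin.append (Θ ∘ z a) (z b))) ∧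
    (∀ v v', Site.supNorm (Θ v - Θ v') = Site.supNorm (v - v')) ∧
    (∀ v v', Site.l1Dist (Θ v) (Θ v') = Site.l1Dist v v') ∧
    (∀ v v', |φ v + φ v'| ≤ 2 * (Site.supNorm (Θ v - v') : ℤ)) ∧
    (∀ v v', |φ v - φ v'| ≤ (Site.l1Dist v v' : ℤ)) := by
  set θ : Site 3 → Site 3 := fun x => Function.update x i (-x i) with hθ
  set w : Site 3 := Pi.single i c with hw
  obtain ⟨hsym, hRP⟩ := sym_and_rp_of_levelMirror θ (mirror_involutive i)
    (fun x y h => mirror_adj i h) (fun x => x i) (fun x => by simp [hθ]) (fun x hx0 => by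
      have hx0' : x i = 0 := hx0
      show Function.update x i (-x i) = x
      rw [hx0', neg_zero, ← hx0', Function.update_eq_self])
    (fun x y h => apply_le_add_one_of_adj i h) (fun L x => mem_box_iff_mirror_mem_box i L x)
  obtain ⟨h1, h2, h3, h4⟩ := mirror_conj (Θ := θ) (φ := fun x => x i) (mirror_involutive i)
    (fun x => by simp [hθ]) hsym hRP w
  -- coordinates of the conjugate mirror
  have hΘi : ∀ v, (θ (v - w) + w) i = 2 * c - v i := fun v => by
    simp [hθ, hw]; ring
  have hΘk : ∀ v k, k ≠ i → (θ (v - w) + w) k = v k := fun v k hk => by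
    simp [hθ, hw, hk]
  refine ⟨fun v => θ (v - w) + w, fun v => (v - w) i, fun v => by simp [hw], h1, h2, h3, h4,
    fun v v' => ?_, fun v v' => ?_, fun v v' => ?_, fun v v' => ?_⟩ <;> beta_reduce
  · refine supNorm_eq_of_natAbs_perm (Equiv.refl _) fun k => ?_
    simp only [Equiv.refl_apply, Pi.sub_apply]
    by_cases hk : k = i
    · subst hk; rw [hΘi, hΘi]; omega
    · rw [hΘk v k hk, hΘk v' k hk]
  · refine l1Dist_eq_of_natAbs_perm (Equiv.refl _) fun k => ?_
    simp only [Equiv.refl_apply]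
    by_cases hk : k = i
    · subst hk; rw [hΘi, hΘi]; omega
    · rw [hΘk v k hk, hΘk v' k hk]
  · have h := abs_apply_le_supNorm (θ (v - w) + w - v') i
    rw [Pi.sub_apply, hΘi] at h
    have hw' : (v - w) i = v i - c := by simp [hw]
    have hw'' : (v' - w) i = v' i - c := by simp [hw]
    rw [hw', hw'']
    rw [show v i - c + (v' i - c) = -(2 * c - v i - v' i) by ring, abs_neg]
    have h0 : (0 : ℤ) ≤ Site.supNorm (θ (v - w) + w - v') := by positivity
    linarith
  · have h := abs_sub_apply_le_l1Dist v v' i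
    have hw' : (v - w) i = v i - c := by simp [hw]
    have hw'' : (v' - w) i = v' i - c := by simp [hw]
    rw [hw', hw'', show v i - c - (v' i - c) = v i - v' i by ring]
    exact h

/-- **Diagonal mirrors `v_i - v_j = c`** (`i ≠ j`). With `Θ v = Θ₀ (v - c e_i) + c e_i`, `Θ₀` the
transposition of the coordinates `i, j`, and level `φ v = v_i - v_j - c`: involution, antisymmetric
level, `criticalCorr 3` invariant, RP on `{φ ≥ 0}`, `Θ` a sup-norm and `ℓ¹` isometry,
`|φ v + φ v'| ≤ 2‖Θ v - v'‖_∞` and `|φ v - φ v'| ≤ ‖v - v'‖₁`. [cite: FrohlichEtAl1978, §3 Thm 3.1] -/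
theorem diagMirror {i j : Fin 3} (hij : i ≠ j) (c : ℤ) :
    ∃ (Θ : Site 3 → Site 3) (φ : Site 3 → ℤ), (∀ v, φ v = v i - v j - c) ∧
    (∀ v, Θ (Θ v) = v) ∧ (∀ v, φ (Θ v) = -φ v) ∧
    (∀ (n : ℕ) (y : Fin n → Site 3), criticalCorr 3 n (Θ ∘ y) = criticalCorr 3 n y) ∧
    (∀ (m : ℕ) (k : Fin m → ℕ) (z : (a : Fin m) → Fin (k a) → Site 3) (cf : Fin m → ℝ),
      (∀ a j, 0 ≤ φ (z a j)) →
      0 ≤ ∑ a, ∑ b, cf a * cf b * criticalCorr 3 (k a + k b) (Fin.append (Θ ∘ z a) (z b))) ∧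
    (∀ v v', Site.supNorm (Θ v - Θ v') = Site.supNorm (v - v')) ∧
    (∀ v v', Site.l1Dist (Θ v) (Θ v') = Site.l1Dist v v') ∧
    (∀ v v', |φ v + φ v'| ≤ 2 * (Site.supNorm (Θ v - v') : ℤ)) ∧
    (∀ v v', |φ v - φ v'| ≤ (Site.l1Dist v v' : ℤ)) := by
  set θ : Site 3 → Site 3 := fun x => x ∘ Equiv.swap i j with hθ
  set w : Site 3 := Pi.single i c with hw
  have hθi : ∀ x : Site 3, θ x i = x j := fun x => by simp [hθ, Equiv.swap_apply_left]
  have hθj : ∀ x : Site 3, θ x j = x i := fun x => by simp [hθ, Equiv.swap_apply_right]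
  have hθk : ∀ (x : Site 3) k, k ≠ i → k ≠ j → θ x k = x k := fun x k hki hkj => by
    simp [hθ, Equiv.swap_apply_of_ne_of_ne hki hkj]
  obtain ⟨hsym, hRP⟩ := sym_and_rp_of_levelMirror θ (swapMirror_involutive i j)
    (fun x y h => by
      have h' := zdGraph_adj_signedPerm (Equiv.swap i j) 1 h
      rw [← swapMirror_eq_signedPerm] at h'
      exact h')
    (fun x => x i - x j) (fun x => by rw [hθi, hθj]; ring) (fun x hx0 => by
      have hx0' : x i - x j = 0 := hx0
      funext l
      by_cases hli : l = i
      · subst hli; rw [hθi]; omega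
      · by_cases hlj : l = j
        · subst hlj; rw [hθj]; omega
        · rw [hθk x l hli hlj])
    (fun x y h => sub_le_add_one_of_adj i j h)
    (fun L x => by
      have h' := (signedPerm_mem_box_iff (Equiv.swap i j) 1 (n := L) (x := x)).symm
      rw [← swapMirror_eq_signedPerm] at h'
      exact h')
  obtain ⟨h1, h2, h3, h4⟩ := mirror_conj (Θ := θ) (φ := fun x => x i - x j)
    (swapMirror_involutive i j) (fun x => by rw [hθi, hθj]; ring) hsym hRP w
  -- coordinates of the conjugate mirror
  have hwi : w i = c := by simp [hw]
  have hwj : w j = 0 := by simp [hw, hij.symm]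
  have hΘi : ∀ v, (θ (v - w) + w) i = v j + c := fun v => by
    rw [Pi.add_apply, hθi, Pi.sub_apply, hwj, hwi]; ring
  have hΘj : ∀ v, (θ (v - w) + w) j = v i - c := fun v => by
    rw [Pi.add_apply, hθj, Pi.sub_apply, hwi, hwj]; ring
  have hΘk : ∀ v k, k ≠ i → k ≠ j → (θ (v - w) + w) k = v k := fun v k hki hkj => by
    rw [Pi.add_apply, hθk _ k hki hkj, Pi.sub_apply]
    simp [hw, hki]
  have hφ : ∀ v, (v - w) i - (v - w) j = v i - v j - c := fun v => by
    rw [Pi.sub_apply, Pi.sub_apply, hwi, hwj]; ring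
  refine ⟨fun v => θ (v - w) + w, fun v => (v - w) i - (v - w) j, hφ, h1, h2, h3, h4,
    fun v v' => ?_, fun v v' => ?_, fun v v' => ?_, fun v v' => ?_⟩ <;> beta_reduce
  · refine supNorm_eq_of_natAbs_perm (Equiv.swap i j) fun k => ?_
    simp only [Pi.sub_apply]
    by_cases hki : k = i
    · subst hki; rw [Equiv.swap_apply_left, hΘi, hΘi]; ring_nf
    · by_cases hkj : k = j
      · subst hkj; rw [Equiv.swap_apply_right, hΘj, hΘj]; ring_nf
      · rw [Equiv.swap_apply_of_ne_of_ne hki hkj, hΘk v k hki hkj, hΘk v' k hki hkj]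
  · refine l1Dist_eq_of_natAbs_perm (Equiv.swap i j) fun k => ?_
    by_cases hki : k = i
    · subst hki; rw [Equiv.swap_apply_left, hΘi, hΘi]; ring_nf
    · by_cases hkj : k = j
      · subst hkj; rw [Equiv.swap_apply_right, hΘj, hΘj]; ring_nf
      · rw [Equiv.swap_apply_of_ne_of_ne hki hkj, hΘk v k hki hkj, hΘk v' k hki hkj]
  · have hi' := abs_apply_le_supNorm (θ (v - w) + w - v') i
    have hj' := abs_apply_le_supNorm (θ (v - w) + w - v') j
    rw [Pi.sub_apply, hΘi] at hi'
    rw [Pi.sub_apply, hΘj] at hj'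
    rw [hφ, hφ, show v i - v j - c + (v' i - v' j - c) = (v i - c - v' j) - (v j + c - v' i) by ring]
    exact (abs_sub _ _).trans (by linarith)
  · rw [hφ, hφ, show v i - v j - c - (v' i - v' j - c) = (v i - v' i) - (v j - v' j) by ring]
    exact (abs_sub _ _).trans (abs_sub_add_abs_sub_le_l1Dist v v' hij)

/-- **Anti-diagonal mirrors `v_i + v_j = c`** (`i ≠ j`). With `Θ v = Θ₀ (v - c e_i) + c e_i`, `Θ₀`
the signed transposition `(v_i, v_j) ↦ (-v_j, -v_i)`, and level `φ v = v_i + v_j - c`: involution,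
antisymmetric level, `criticalCorr 3` invariant, RP on `{φ ≥ 0}`, `Θ` a sup-norm and `ℓ¹` isometry,
`|φ v + φ v'| ≤ 2‖Θ v - v'‖_∞` and `|φ v - φ v'| ≤ ‖v - v'‖₁`. [cite: FrohlichEtAl1978, §3 Thm 3.1] -/
theorem antiMirror {i j : Fin 3} (hij : i ≠ j) (c : ℤ) :
    ∃ (Θ : Site 3 → Site 3) (φ : Site 3 → ℤ), (∀ v, φ v = v i + v j - c) ∧
    (∀ v, Θ (Θ v) = v) ∧ (∀ v, φ (Θ v) = -φ v) ∧
    (∀ (n : ℕ) (y : Fin n → Site 3), criticalCorr 3 n (Θ ∘ y) = criticalCorr 3 n y) ∧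
    (∀ (m : ℕ) (k : Fin m → ℕ) (z : (a : Fin m) → Fin (k a) → Site 3) (cf : Fin m → ℝ),
      (∀ a j, 0 ≤ φ (z a j)) →
      0 ≤ ∑ a, ∑ b, cf a * cf b * criticalCorr 3 (k a + k b) (Fin.append (Θ ∘ z a) (z b))) ∧
    (∀ v v', Site.supNorm (Θ v - Θ v') = Site.supNorm (v - v')) ∧
    (∀ v v', Site.l1Dist (Θ v) (Θ v') = Site.l1Dist v v') ∧
    (∀ v v', |φ v + φ v'| ≤ 2 * (Site.supNorm (Θ v - v') : ℤ)) ∧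
    (∀ v v', |φ v - φ v'| ≤ (Site.l1Dist v v' : ℤ)) := by
  set θ : Site 3 → Site 3 := fun x => Function.update (Function.update x i (-x j)) j (-x i) with hθ
  set w : Site 3 := Pi.single i c with hw
  have hθi : ∀ x : Site 3, θ x i = -x j := fun x => by
    simp [hθ, Function.update_of_ne hij]
  have hθj : ∀ x : Site 3, θ x j = -x i := fun x => by simp [hθ]
  have hθk : ∀ (x : Site 3) k, k ≠ i → k ≠ j → θ x k = x k := fun x k hki hkj => by
    simp [hθ, Function.update_of_ne hkj, Function.update_of_ne hki]
  obtain ⟨hsym, hRP⟩ := sym_and_rp_of_levelMirror θ (antiMirror_involutive hij)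
    (fun x y h => by
      have h' := zdGraph_adj_signedPerm (Equiv.swap i j) (fun l => if l = i ∨ l = j then -1 else 1) h
      rw [← antiMirror_eq_signedPerm hij] at h'
      exact h')
    (fun x => x i + x j) (fun x => by rw [hθi, hθj]; ring) (fun x hx0 => by
      have hx0' : x i + x j = 0 := hx0
      funext l
      by_cases hli : l = i
      · subst hli; rw [hθi]; omega
      · by_cases hlj : l = j
        · subst hlj; rw [hθj]; omega
        · rw [hθk x l hli hlj])
    (fun x y h => add_le_add_one_of_adj hij h)
    (fun L x => by
      have h' := (signedPerm_mem_box_iff (Equiv.swap i j)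
        (fun l => if l = i ∨ l = j then -1 else 1) (n := L) (x := x)).symm
      rw [← antiMirror_eq_signedPerm hij] at h'
      exact h')
  obtain ⟨h1, h2, h3, h4⟩ := mirror_conj (Θ := θ) (φ := fun x => x i + x j)
    (antiMirror_involutive hij) (fun x => by rw [hθi, hθj]; ring) hsym hRP w
  -- coordinates of the conjugate mirror
  have hwi : w i = c := by simp [hw]
  have hwj : w j = 0 := by simp [hw, hij.symm]
  have hΘi : ∀ v, (θ (v - w) + w) i = c - v j := fun v => by
    rw [Pi.add_apply, hθi, Pi.sub_apply, hwj, hwi]; ring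
  have hΘj : ∀ v, (θ (v - w) + w) j = c - v i := fun v => by
    rw [Pi.add_apply, hθj, Pi.sub_apply, hwi, hwj]; ring
  have hΘk : ∀ v k, k ≠ i → k ≠ j → (θ (v - w) + w) k = v k := fun v k hki hkj => by
    rw [Pi.add_apply, hθk _ k hki hkj, Pi.sub_apply]
    simp [hw, hki]
  have hφ : ∀ v, (v - w) i + (v - w) j = v i + v j - c := fun v => by
    rw [Pi.sub_apply, Pi.sub_apply, hwi, hwj]; ring
  refine ⟨fun v => θ (v - w) + w, fun v => (v - w) i + (v - w) j, hφ, h1, h2, h3, h4,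
    fun v v' => ?_, fun v v' => ?_, fun v v' => ?_, fun v v' => ?_⟩ <;> beta_reduce
  · refine supNorm_eq_of_natAbs_perm (Equiv.swap i j) fun k => ?_
    simp only [Pi.sub_apply]
    by_cases hki : k = i
    · subst hki; rw [Equiv.swap_apply_left, hΘi, hΘi]; omega
    · by_cases hkj : k = j
      · subst hkj; rw [Equiv.swap_apply_right, hΘj, hΘj]; omega
      · rw [Equiv.swap_apply_of_ne_of_ne hki hkj, hΘk v k hki hkj, hΘk v' k hki hkj]
  · refine l1Dist_eq_of_natAbs_perm (Equiv.swap i j) fun k => ?_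
    by_cases hki : k = i
    · subst hki; rw [Equiv.swap_apply_left, hΘi, hΘi]; omega
    · by_cases hkj : k = j
      · subst hkj; rw [Equiv.swap_apply_right, hΘj, hΘj]; omega
      · rw [Equiv.swap_apply_of_ne_of_ne hki hkj, hΘk v k hki hkj, hΘk v' k hki hkj]
  · have hi' := abs_apply_le_supNorm (θ (v - w) + w - v') i
    have hj' := abs_apply_le_supNorm (θ (v - w) + w - v') j
    rw [Pi.sub_apply, hΘi] at hi'
    rw [Pi.sub_apply, hΘj] at hj'
    rw [hφ, hφ, show v i + v j - c + (v' i + v' j - c) = -((c - v j - v' i) + (c - v i - v' j)) by ring,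
      abs_neg]
    exact (abs_add_le _ _).trans (by linarith)
  · rw [hφ, hφ, show v i + v j - c - (v' i + v' j - c) = (v i - v' i) + (v j - v' j) by ring]
    exact (abs_add_le _ _).trans (abs_sub_add_abs_sub_le_l1Dist v v' hij)

end Summit.CriticalPhenomena.Ising3DConformalLimit.MirrorHoelderCompactnessSeparableHoelder

end
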